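import Summits.FinalStateConjecture.FinalStateConjecture.Statement
import Literature.Geometry.Lorentzian.MinkowskiGlobalHyperbolicity

/-!
# Solo (blind) — what the exhaustion clause does and does not constrain

Three elementary facts about the covering conjunct of `HasExhaustiveCharts`,
`∀ τ₁ > τ₀, O \ certifiedLate d R τ₁ ⊆ J⁻(certifiedSlab d R τ₁)`, recorded for the audit
`paper/audit-s29.md` of the solo (blind) residency.

* `soloBlind_exhaustion_of_cofinal` — the LOOPHOLE: the covering conjunct holds as soon as, for
  every chart time `τ₁ > τ₀`, every point of `O` causally precedes SOME point of the certified slab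
  at `τ₁`. Since `flatDomain` is an arbitrary open superset of the late half-space minus the excised
  tubes, a witness with `N ≥ 1` may add countably many tiny flat balls ("motes") inside a tube in
  coordinates and place their images on timelike geodesics at unboundedly late times; their causal
  pasts then cover `O` and the conjunct carries no further content (audit-s29 §3).
* `soloBlind_disjoint_of_exhaustion` / `soloBlind_exterior_disjoint_futureSet` — what the conjunct
  DOES give: the region `O` of an exhaustive decomposition is disjoint from every future set `F`
  (`J⁺(p) ⊆ F` for `p ∈ F`) which the certified slabs eventually avoid. The only other input is that
  a point lies in `certifiedLate d R τ₁` for a bounded set of `τ₁` (`soloBlind_eventually_not_mem_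
  certifiedLate`, from injectivity of the `N + 1` late charts). Applied to the interior of a
  two-ended black hole (avoided by late slabs for curvature reasons) this is the "no interior
  charting" lemma of audit-s29 §5.
* `soloBlind_radiationZone_subset_or` — if moreover the late flat coordinate domain is
  preconnected (the typing amendment TF₀ discussed in audit-s29 §7) and `O` lies in the union of two
  disjoint open sets, the whole late flat image lies in one of them.

References: B. O'Neill, *Semi-Riemannian geometry*, Academic Press 1983, Ch. 14, pp. 402–403
(causal relations, time duality); the typed clause `HasExhaustiveCharts` (Statement.lean).
-/

noncomputable section

open Literature.Geometry.Lorentzian Set Filter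
open scoped Manifold ContDiff Topology

set_option linter.dupNamespace false

namespace Summit.FinalStateConjecture.FinalStateConjecture.Theorems

section General

variable {E : Type*} [NormedAddCommGroup E] [NormedSpace ℝ E] {H : Type*} [TopologicalSpace H]
  {I : ModelWithCorners ℝ E H} {n : ℕ∞ω} {M : Type*} [TopologicalSpace M] [ChartedSpace H M]
  [IsManifold I ∞ M] {g : LorentzianMetric I n M} {τ : TimeOrientation g}

/-- The causal past of a set disjoint from a future set `F` is disjoint from `F`.
O'Neill 1983, Ch. 14, pp. 402–403. -/
theorem soloBlind_causalPast_disjoint_of_futureSet {S F : Set M}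
    (hF : ∀ p ∈ F, g.causalFuture τ {p} ⊆ F) (hS : Disjoint S F) :
    Disjoint (g.causalPast τ S) F := by
  rw [Set.disjoint_left]
  intro p hp hpF
  have h2 := (Set.ext_iff.1 (LorentzianMetric.causalFuture_eq_biUnion (g := g) (τ := τ.reverse) S)
    p).1 hp
  obtain ⟨q, hqS, hpq⟩ := Set.mem_iUnion₂.1 h2
  have hqp : q ∈ g.causalFuture τ {p} := LorentzianMetric.mem_causalPast_singleton_iff.1 hpq
  exact (Set.disjoint_left.1 hS) hqS (hF p hpF hqp)

/-- **Exhaustion keeps `O` out of avoided future sets.** If `O \ C τ₁ ⊆ J⁻(S τ₁)` for all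
`τ₁ > τ₀`, `F` is a future set, the "slabs" `S τ₁` are eventually disjoint from `F`, and every
point of `O` lies in `C τ₁` only for a bounded-above set of `τ₁`, then `O ∩ F = ∅`.
O'Neill 1983, Ch. 14, pp. 402–403. -/
theorem soloBlind_disjoint_of_exhaustion {O F : Set M} {C S : ℝ → Set M} {τ₀ : ℝ}
    (hcov : ∀ τ₁, τ₀ < τ₁ → O \ C τ₁ ⊆ g.causalPast τ (S τ₁))
    (hF : ∀ p ∈ F, g.causalFuture τ {p} ⊆ F) (hS : ∀ᶠ τ₁ in atTop, Disjoint (S τ₁) F)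
    (hfin : ∀ p ∈ O, ∀ᶠ τ₁ in atTop, p ∉ C τ₁) : Disjoint O F := by
  rw [Set.disjoint_left]
  intro p hpO hpF
  obtain ⟨τ₁, ⟨hS₁, hC₁⟩, hgt⟩ := ((hS.and (hfin p hpO)).and (eventually_gt_atTop τ₀)).exists
  have hp : p ∈ g.causalPast τ (S τ₁) := hcov τ₁ hgt ⟨hpO, hC₁⟩
  exact Set.disjoint_left.1 (soloBlind_causalPast_disjoint_of_futureSet hF hS₁) hp hpF

end General

section Decomposition

variable {𝓢 : Spacetime.{0} 4} {O : Set 𝓢.carrier} {k : ℕ}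

/-- **The loophole.** The covering conjunct of `HasExhaustiveCharts` holds as soon as every point
of `O` causally precedes, for every `τ₁ > τ₀`, some point of the certified slab at `τ₁` — e.g. one
of countably many floating flat balls placed at unboundedly late times (audit-s29 §3).
O'Neill 1983, Ch. 14, p. 402. -/
theorem soloBlind_exhaustion_of_cofinal (d : FinalStateDecomposition 𝓢 O k)
    (R : Fin d.N → ℝ → ℝ)
    (h : ∀ τ₁, d.τ₀ < τ₁ → ∀ p ∈ O, ∃ q ∈ certifiedSlab d R τ₁,
      q ∈ 𝓢.metric.causalFuture 𝓢.timeOrientation {p}) :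
    ∀ τ₁, d.τ₀ < τ₁ → O \ certifiedLate d R τ₁ ⊆
      𝓢.metric.causalPast 𝓢.timeOrientation (certifiedSlab d R τ₁) := by
  intro τ₁ hτ₁ p hp
  obtain ⟨q, hq, hpq⟩ := h τ₁ hτ₁ p hp.1
  exact LorentzianMetric.causalFuture_mono (τ := 𝓢.timeOrientation.reverse)
    (Set.singleton_subset_iff.2 hq) (LorentzianMetric.mem_causalPast_singleton_iff.2 hpq)

/-- A late chart hits a given point from `{t > τ₁}` only for a bounded-above set of `τ₁`
(injectivity on the late region `{t > τ₀}`). DHRT arXiv:2104.08222, §1. -/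
theorem soloBlind_eventually_forall_ne {B : ModelBackground} {𝒟 : Set 𝓢.carrier} {τ₀ : ℝ}
    {Ψ : B.domain → 𝓢.carrier} (hΨ : 𝓢.IsLateChart B 𝒟 τ₀ Ψ) (p : 𝓢.carrier) :
    ∀ᶠ τ₁ in atTop, ∀ x : B.domain, τ₁ < B.time x.1 → Ψ x ≠ p := by
  by_cases h : ∃ x : B.domain, τ₀ < B.time x.1 ∧ Ψ x = p
  · obtain ⟨x₀, hx₀, hx₀p⟩ := h
    filter_upwards [eventually_ge_atTop (B.time x₀.1), eventually_gt_atTop τ₀] with τ₁ h₁ h₀ x hx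
      hxp
    have hxl : x ∈ B.lateRegion τ₀ := lt_trans h₀ hx
    have hx₀l : x₀ ∈ B.lateRegion τ₀ := hx₀
    have heq : (B.lateRegion τ₀).restrict Ψ ⟨x, hxl⟩ = (B.lateRegion τ₀).restrict Ψ ⟨x₀, hx₀l⟩ := by
      simp only [Set.restrict_apply, hxp, hx₀p]
    have hxx : x = x₀ := congrArg Subtype.val (hΨ.isOpenEmbedding.injective heq)
    subst hxx
    exact absurd (lt_of_le_of_lt h₁ hx) (lt_irrefl _)
  · push Not at h
    filter_upwards [eventually_gt_atTop τ₀] with τ₁ h₀ x hx hxp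
    exact h x (lt_trans h₀ hx) hxp

/-- Every point lies in `certifiedLate d R τ₁` only for a bounded-above set of chart times `τ₁`
(the `N + 1` late charts are injective on their late regions). DHRT arXiv:2104.08222, §1. -/
theorem soloBlind_eventually_not_mem_certifiedLate (d : FinalStateDecomposition 𝓢 O k)
    (R : Fin d.N → ℝ → ℝ) (p : 𝓢.carrier) : ∀ᶠ τ₁ in atTop, p ∉ certifiedLate d R τ₁ := by
  have hflat := soloBlind_eventually_forall_ne d.isLateChart_flat p
  have hker : ∀ i, ∀ᶠ τ₁ in atTop, ∀ x : (d.background i).domain,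
      τ₁ < (d.background i).time x.1 → d.chart i x ≠ p :=
    fun i ↦ soloBlind_eventually_forall_ne (d.isLateChart i) p
  filter_upwards [hflat, eventually_all.2 hker] with τ₁ h₁ h₂
  rintro (⟨x, hx, hxp⟩ | hmem)
  · exact h₁ x hx hxp
  · obtain ⟨i, x, ⟨hxτ, -⟩, hxp⟩ := Set.mem_iUnion.1 hmem
    exact h₂ i x hxτ hxp

/-- **No charting of avoided future sets.** For an exhaustive decomposition `d` of `O`
(`HasExhaustiveCharts d`), `O` is disjoint from every future set `F` which, for every choice of
near-zone radii, the certified slabs eventually avoid. (Audit-s29 §5 applies this to the interior of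
a two-ended black hole, which late `C²`-near-flat and `C²`-near-Kerr-exterior slabs avoid for
curvature reasons: no witness charts it, so the charted exterior splits into the two sides.)
O'Neill 1983, Ch. 14, pp. 402–403. -/
theorem soloBlind_exterior_disjoint_futureSet (d : FinalStateDecomposition 𝓢 O k)
    (hex : HasExhaustiveCharts d) {F : Set 𝓢.carrier}
    (hF : ∀ p ∈ F, 𝓢.metric.causalFuture 𝓢.timeOrientation {p} ⊆ F)
    (hS : ∀ R : Fin d.N → ℝ → ℝ, ∀ᶠ τ₁ in atTop, Disjoint (certifiedSlab d R τ₁) F) :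
    Disjoint O F := by
  obtain ⟨R, -, -, hcov⟩ := hex
  exact soloBlind_disjoint_of_exhaustion hcov hF (hS R)
    (fun p _ ↦ soloBlind_eventually_not_mem_certifiedLate d R p)

/-- **Sides.** If the late flat coordinate domain `{x⁰ > τ₀} ∩ U₀` is preconnected (typing
amendment TF₀ of audit-s29 §7) and `O` lies in the union of two disjoint open sets, then the whole
radiation zone (late flat image) lies in one of them. Mathlib `IsPreconnected.subset_or_subset`. -/
theorem soloBlind_radiationZone_subset_or (d : FinalStateDecomposition 𝓢 O k)
    (hconn : IsPreconnected ((Minkowski.backgroundOn d.flatDomain).lateRegion d.τ₀))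
    {A B : Set 𝓢.carrier} (hA : IsOpen A) (hB : IsOpen B) (hAB : Disjoint A B)
    (hO : O ⊆ A ∪ B) : d.radiationZone ⊆ A ∨ d.radiationZone ⊆ B :=
  (hconn.image d.flatChart d.isLateChart_flat.contMDiff.continuous.continuousOn).subset_or_subset
    hA hB hAB (d.radiationZone_subset.trans hO)

end Decomposition

end Summit.FinalStateConjecture.FinalStateConjecture.Theorems
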